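import Summits.NavierStokesRegularity.NavierStokesRegularity.Theorems.NoOverheating.Negative.ExcludedStrataCensusV4
import Summits.NavierStokesRegularity.NavierStokesRegularity.Theorems.NoOverheating.Negative.SineFormAlignmentExcluded

/-!
# KJ-50 — CENSUS v5 of the excluded strata of route `AngularGalerkinLadder`'s window sequences
# ((S0)–(S12) of `excludedStrata_windowSequences_v4` + (S13) sign-free aligned vorticity directions)

Refuter lineage, Negative lane of crux K2 `NoOverheating` (supports, does not decide).  Pure
assembly — this file proves NOTHING new: it folds kernel row KJ-49 into the census statement of
record, `excludedStrata_windowSequences_v5`, "what an admissible window sequence of K2 can NOT be":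

* (S13) the SIGN-FREE VORTICITY-DIRECTION corner (Constantin–Fefferman 1993 / Beirão da
  Veiga–Berselli 2002, Lemarié-Rieusset 2016 Thm 11.7: `|ξ(x) ∧ ξ(y)|`, antiparallel vorticity
  allowed): SOME profile whose vorticity directions satisfy, on the window `(−1, 0) × ℝ³` above SOME
  threshold `d₀` with SOME modulus `η → 0⁺`,
  `min (‖ξ(x) − ξ(y)‖) (‖ξ(x) + ξ(y)‖) ≤ η(‖x − y‖)` (`no_windowProfile_sineAlignment`, KJ-49: the
  unsigned defect transports across DSS periods, self-improves to line-parallel slice vorticity,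
  which is translation invariant by Giga–Miura's slice lemma and killed by Type-I decay; one profile,
  no limit).  Rows (S9a)/(S9b) (signed, every profile) and (S12) (line-parallel `t = −1` slice) of
  v4 are special cases but are kept verbatim so that v4 consumers can switch by name.

WHAT ESCAPES every row of v5: `C₀ > ε₀`; genuinely discrete RDSS whose usable powers twist in
Pineau–Vicol's open middle band (or meet only coarse windows); no hidden factor below `λ₁(C₀)`;
hidden continuous rotation (if any) with speeds eventually inside `(β₁, β₂)`; a non-degenerate
degree-`−1` tail germ; vorticity directions with NO modulus at ANY threshold on `(−1, 0)`, signed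
or sign-free (for an exactly rotated-DSS profile the generic case: any modulus is rigid); no
isometric symmetry with unbounded orbits; every profile singular at `(0,0)`.  WHAT THIS IS NOT:
not `¬NoOverheating`; no new Literature fact, no definition; standard axioms only.
[cite: BeiraodaveigaBerselli2002, Theorem 1.1 (as quoted in Lemarié-Rieusset 2016, Thm 11.7, PDF p. 369)]
[cite: ConstantinFefferman1993, §1]
[cite: GigaMiura2011, Theorem 1.3 and Proposition 2.2] -/

namespace Summit.NavierStokesRegularity.AngularGalerkinLadderExcludedStrataCensusV5

open Set Filter MeasureTheory Topology Function
open scoped ENNReal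
open Literature.Analysis Literature.Analysis.FluidPDE
open Summit.NavierStokesRegularity.FluidComputer
open Summit.NavierStokesRegularity.NavierStokesRegularity.Theses.AngularGalerkinLadder
open Summit.NavierStokesRegularity.AngularGalerkinLadderExcludedStrataCensusV4
open Summit.NavierStokesRegularity.AngularGalerkinLadderSineFormAlignmentExcluded

/-- **Census theorem v5: the excluded strata (S0)–(S13) of K2's window sequences.**  As
`excludedStrata_windowSequences_v4`, plus (S13): some profile whose vorticity directions are
sign-free aligned on `(−1, 0)` above some threshold with some modulus `η → 0⁺` — for ANY window
`1 < cmin ≤ cmax` and ANY rotations.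
[cite: BeiraodaveigaBerselli2002, Theorem 1.1 (as quoted in Lemarié-Rieusset 2016, Thm 11.7, PDF p. 369)] -/
theorem excludedStrata_windowSequences_v5 :
    ∃ ε₀ : ℝ, 0 < ε₀ ∧ ∀ C₀ : ℝ, ∃ κ α₁ c₁ α₂ c₂ lam₁ β₁ β₂ : ℝ,
      1 < κ ∧ 0 < α₁ ∧ 1 < c₁ ∧ 0 < α₂ ∧ 1 < c₂ ∧ 1 < lam₁ ∧ 0 < β₁ ∧ 0 < β₂ ∧
      ∀ {cmin cmax δ : ℝ} {L : ℕ → ℕ} {ε c : ℕ → ℝ}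
        {R : ℕ → (EuclideanSpace ℝ (Fin 3) ≃ₗᵢ[ℝ] EuclideanSpace ℝ (Fin 3))}
        {u : ℕ → ℝ → EuclideanSpace ℝ (Fin 3) → EuclideanSpace ℝ (Fin 3)}
        {p : ℕ → ℝ → EuclideanSpace ℝ (Fin 3) → ℝ}
        {d : ℕ → ℝ → EuclideanSpace ℝ (Fin 3) → EuclideanSpace ℝ (Fin 3)},
        1 < cmin → 0 < δ → Tendsto ε atTop (𝓝 0) →
        (∀ n, AngularLadder.IsWindowProfile (L n) C₀ cmin cmax δ (ε n) (c n) (R n) (u n) (p n)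
          (d n)) →
        ¬ (C₀ ≤ ε₀ ∨
           (∀ n, ∀ t < 0, IsAxisymmetric (u n t)) ∨
           (∃ q : ℕ, 0 < q ∧ cmax ^ q < κ ∧
              ∀ x, Tendsto (fun n => ((R n) ^ q) x) atTop (𝓝 x)) ∨
           (∃ (q : ℕ) (g : ℕ → (EuclideanSpace ℝ (Fin 3) ≃ₗᵢ[ℝ] EuclideanSpace ℝ (Fin 3)))
              (θ : ℕ → ℝ),
              0 < q ∧ cmax ^ q < c₁ ∧ (∀ n x, ((R n) ^ q) x = g n (rotZ (θ n) ((g n).symm x))) ∧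
              ∀ n, |θ n| ≤ 2 * α₁ * (q * Real.log (c n))) ∨
           (∃ (Θ ℓ : ℝ) (g : ℕ → (EuclideanSpace ℝ (Fin 3) ≃ₗᵢ[ℝ] EuclideanSpace ℝ (Fin 3)))
              (θ : ℕ → ℝ),
              ℓ < Real.log c₂ ∧ (∀ n x, R n x = g n (rotZ (θ n) ((g n).symm x))) ∧
              (∀ n, |θ n| ≤ Θ) ∧ (∀ n, 2 * α₂ * Real.log (c n) ≤ |θ n|) ∧
              ∀ n, (1 + (θ n / (2 * Real.log (c n))) ^ 2) * Real.log (c n) ≤ ℓ) ∨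
           (∃ lam : ℝ, 1 < lam ∧ lam < lam₁ ∧ ∀ n, IsDiscretelySelfSimilar lam (u n)) ∨
           (∀ n, IsSelfSimilar (u n)) ∨
           (∃ (g : ℕ → (EuclideanSpace ℝ (Fin 3) ≃ₗᵢ[ℝ] EuclideanSpace ℝ (Fin 3))) (α : ℕ → ℝ),
              (∀ n (μ : ℝ), 1 < μ → IsRotatedDSS μ
                (((g n).symm.trans (rotZLIE (2 * α n * Real.log μ))).trans (g n)) (u n)) ∧
              ∀ n, |α n| ≤ β₁ ∨ β₂ ≤ |α n|) ∨
           (∃ M : ℝ≥0∞, M < ⊤ ∧ ∀ n, eLpNorm (u n (-1)) 3 volume ≤ M) ∨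
           (∃ M : ℝ≥0∞, M < ⊤ ∧ ∀ n, eLpNorm (u n (-1)) 2 volume ≤ M) ∨
           (∀ η : ℝ, 0 < η → ∃ ρ : ℝ, ∀ n x, ρ ≤ ‖x‖ → ‖x‖ * ‖u n (-1) x‖ ≤ η) ∨
           (∀ n, ∀ t < 0, ∃ e : EuclideanSpace ℝ (Fin 3), ∀ x,
              curl (u n t) x = ‖curl (u n t) x‖ • e) ∨
           (∀ n, ∃ (d₀ : ℝ) (η : ℝ → ℝ), Tendsto η (𝓝[>] 0) (𝓝 0) ∧
              ∀ s ∈ Ioo (-1 : ℝ) 0, ∀ x y, d₀ < ‖curl (u n s) x‖ → d₀ < ‖curl (u n s) y‖ →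
                ‖vorticityDirection (curl (u n s)) x - vorticityDirection (curl (u n s)) y‖ ≤
                  η ‖x - y‖) ∨
           (∃ (n : ℕ) (S : EuclideanSpace ℝ (Fin 3) ≃ₗᵢ[ℝ] EuclideanSpace ℝ (Fin 3))
              (b : EuclideanSpace ℝ (Fin 3)), S b = b ∧ b ≠ 0 ∧
              ∀ x, ‖u n (-1) (S x + b)‖ = ‖u n (-1) x‖) ∨
           (∃ (n : ℕ) (ρ B : ℝ), 0 < ρ ∧
              ∀ z ∈ parabolicCylinder ρ (0 : ℝ × EuclideanSpace ℝ (Fin 3)), ‖u n z.1 z.2‖ ≤ B) ∨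
           (∃ (n : ℕ) (U : EuclideanSpace ℝ (Fin 3) → EuclideanSpace ℝ (Fin 3)),
              Continuous U ∧ ∀ t < 0, u n t = U) ∨
           (∃ (n : ℕ) (e : EuclideanSpace ℝ (Fin 3)), ∀ x, ∃ a : ℝ,
              curl (u n (-1)) x = a • e) ∨
           (∃ (n : ℕ) (d₀ : ℝ) (η : ℝ → ℝ), Tendsto η (𝓝[>] 0) (𝓝 0) ∧
              ∀ s ∈ Ioo (-1 : ℝ) 0, ∀ x y, d₀ < ‖curl (u n s) x‖ → d₀ < ‖curl (u n s) y‖ →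
                min ‖vorticityDirection (curl (u n s)) x - vorticityDirection (curl (u n s)) y‖
                    ‖vorticityDirection (curl (u n s)) x + vorticityDirection (curl (u n s)) y‖ ≤
                  η ‖x - y‖)) := by
  obtain ⟨ε₀, hε₀, H⟩ := excludedStrata_windowSequences_v4
  refine ⟨ε₀, hε₀, fun C₀ => ?_⟩
  obtain ⟨κ, α₁, c₁, α₂, c₂, lam₁, β₁, β₂, hκ, hα₁, hc₁, hα₂, hc₂, hlam₁, hβ₁, hβ₂, HC⟩ := H C₀
  refine ⟨κ, α₁, c₁, α₂, c₂, lam₁, β₁, β₂, hκ, hα₁, hc₁, hα₂, hc₂, hlam₁, hβ₁, hβ₂,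
    fun {cmin cmax δ L ε c R u p d} hcmin hδ hε hW => ?_⟩
  have HC' := HC hcmin hδ hε hW
  simp only [not_or] at HC' ⊢
  obtain ⟨h0, h1, h2, h3, h4, h5, h6, h7, h8, h9, h10, h11, h12, h13, h14, h15, h16⟩ := HC'
  exact ⟨h0, h1, h2, h3, h4, h5, h6, h7, h8, h9, h10, h11, h12, h13, h14, h15, h16,
    fun ⟨n, d₀, η, hη, hSA⟩ => no_windowProfile_sineAlignment hδ (hW n) hη hSA⟩

end Summit.NavierStokesRegularity.AngularGalerkinLadderExcludedStrataCensusV5
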